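import Summits.ValiantsHypothesis.ValiantsHypothesis.Theorems.SymPencilPerFourHessianMinors
import Summits.ValiantsHypothesis.ValiantsHypothesis.Theorems.SymPencilPerFourPairingDiscTools

/-!
# Route `SymPencil` — generic alternatives: if at every point of a subspace one of finitely many
# systems of (line-)polynomial equations holds, then one system holds identically
# (`--supports` stmt-ValiantsHypothesis-5674 `SdcSuperquadratic`; (8,8) column, isotropic-kernel route,
# bridge step (B2) of memo `NOTE-p6g15-5674-IR12-reduction.md` §8)

Over an infinite field `K`, let `W ≤ M` be a subspace and let `F α` (`α` in a finite index type) be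
sets of functions `M → K` that are polynomial along every line (`∀ y₀ y, ∃ p, ∀ t, f (y₀ + t • y) =
p.eval t`, the convention of `SymPencilPerFourHessianMinors.forall_eq_zero_or_of_mul₃`).

(`linePoly_mul`, `linePoly_prod` are reused from `SymPencilPerFourPairingDiscTools`.)

* `simul_ne_zero`: if for every `α` some `y_α ∈ W` has `f α y_α ≠ 0`, one `y ∈ W` has `f α y ≠ 0`
  for all `α` (induction with `SymPencilPerFourHessianMinors.exists_ne_zero_and_ne_zero` applied to
  the running product);
* `exists_forall_vanish`: if at every `y ∈ W` some system `F α` vanishes entirely, then some system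
  vanishes on all of `W` ("an irreducible variety is not a finite union of proper closed subsets",
  in the elementary line-polynomial form used by this route).

Use: the five cone dichotomies of the `a`-slot kernel give, at every `a` with `∏ a_i ≠ 0`, one of
finitely many side patterns, each implying a system of polynomial identities in `a`; this lemma
makes ONE pattern's identities hold for every `a`.  Honest framing: elementary infrastructure in a
conditional reduction of the cells `(8,8,10)`, `(8,8,11)`; nothing about the window, the crux or
`VP ≠ VNP`.  No definitions, no named facts. [folklore]
-/

noncomputable section

-- single-conjunct layout: Sub = Summit, duplicated namespace component intended
set_option linter.dupNamespace false

namespace Summit.ValiantsHypothesis.ValiantsHypothesis.Theorems.SymPencilPerFourInnerRankGenericAlt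

open Polynomial
open Summit.ValiantsHypothesis.ValiantsHypothesis.Theorems.SymPencilPerFourHessianMinors
open Summit.ValiantsHypothesis.ValiantsHypothesis.Theorems.SymPencilPerFourPairingDiscTools

variable {K : Type*} [Field K] {M : Type*} [AddCommGroup M] [Module K M]

/-- **Simultaneous non-vanishing.**  If each `f α` is line-polynomial and does not vanish
identically on the subspace `W`, a single point of `W` avoids all of them. [folklore] -/
theorem simul_ne_zero [Infinite K] (W : Submodule K M) {A : Type*} [DecidableEq A]
    (s : Finset A) (f : A → M → K)
    (hf : ∀ α, ∀ y₀ y : M, ∃ p : K[X], ∀ t : K, f α (y₀ + t • y) = p.eval t)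
    (hne : ∀ α ∈ s, ∃ y ∈ W, f α y ≠ 0) :
    ∃ y ∈ W, ∀ α ∈ s, f α y ≠ 0 := by
  induction s using Finset.induction_on with
  | empty => exact ⟨0, W.zero_mem, fun α hα => absurd hα (Finset.notMem_empty α)⟩
  | @insert a s ha ih =>
    obtain ⟨y₀, hy₀, h₀⟩ := ih fun α hα => hne α (Finset.mem_insert_of_mem hα)
    obtain ⟨y₁, hy₁, h₁⟩ := hne a (Finset.mem_insert_self a s)
    have hg := linePoly_prod s (f := f) (fun α _ => hf α)
    have hgy₀ : (fun z => ∏ α ∈ s, f α z) y₀ ≠ 0 := by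
      simp only
      exact Finset.prod_ne_zero_iff.2 h₀
    obtain ⟨y, hy, hgy, hfy⟩ :=
      exists_ne_zero_and_ne_zero W (f := fun z => ∏ α ∈ s, f α z) (g := f a) hg (hf a) hy₀ hy₁
        hgy₀ h₁
    refine ⟨y, hy, fun α hα => ?_⟩
    rcases Finset.mem_insert.1 hα with rfl | hα'
    · exact hfy
    · exact (Finset.prod_ne_zero_iff.1 hgy) α hα'

/-- **Generic alternatives.**  If at every point of `W` one of finitely many systems `F α` of
line-polynomial functions vanishes entirely, then one system vanishes on all of `W`. [folklore] -/
theorem exists_forall_vanish [Infinite K] (W : Submodule K M) {A : Type*} [Fintype A]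
    [DecidableEq A] (F : A → Set (M → K))
    (hF : ∀ α, ∀ f ∈ F α, ∀ y₀ y : M, ∃ p : K[X], ∀ t : K, f (y₀ + t • y) = p.eval t)
    (h : ∀ y ∈ W, ∃ α, ∀ f ∈ F α, f y = 0) :
    ∃ α, ∀ y ∈ W, ∀ f ∈ F α, f y = 0 := by
  by_contra hcon
  push Not at hcon
  -- for every `α` pick a witness function and a point of `W` where it does not vanish
  choose y hyW f hfF hfy using hcon
  obtain ⟨z, hz, hall⟩ := simul_ne_zero W Finset.univ f (fun α => hF α (f α) (hfF α))
    (fun α _ => ⟨y α, hyW α, hfy α⟩)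
  obtain ⟨α, hα⟩ := h z hz
  exact hall α (Finset.mem_univ α) (hα (f α) (hfF α))

end Summit.ValiantsHypothesis.ValiantsHypothesis.Theorems.SymPencilPerFourInnerRankGenericAlt

end
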